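import Mathlib
import Summits.ValiantsHypothesis.ValiantsHypothesis.Theorems.ValuativeGCTValuativeFlipTridiagonalCofactorSpan
import Summits.ValiantsHypothesis.ValiantsHypothesis.Theorems.ValuativeGCTValuativeFlipDetPencilPrelims
import Summits.ValiantsHypothesis.ValiantsHypothesis.Theorems.ValuativeGCTValuativeFlipTwoRowNoFlip
import Summits.ValiantsHypothesis.ValiantsHypothesis.Theorems.ValuativeGCTValuativeFlipDetEqFreeTwoLetters

/-!
# Ternary forms are border-determinantal (row 3 of the few-row table: theorem and corollaries)

Crux `ValuativeGCT.ValuativeFlip` (stmt-ValiantsHypothesis-12624), wall-breaker axis 14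
("plethysm tables, small cases certified"), gen 1 (over `…TridiagonalCofactorSpan`, `…DetPencilPrelims`).

**Theorem** (`topThreeForms_mem_orbitClosure_detFormLex`, registered stub; generic form of
Dickson's 1921 theorem that plane curves are determinantal, in the closure form GCT needs). For
every `m ≥ 1`, every form of degree `m` in (any) three letters of the `m²` matrix variables lies in
the orbit closure `Δ(det_m) = \overline{GL_{m²} · det_m}`.

Proof. (1) SUBMERSION: at the tridiagonal Toeplitz pencil `T = x·1 + y·N + z·Nᵀ` the
differential of `Φ : (A₀, A₁, A₂) ↦ det(x A₀ + y A₁ + z A₂)` (on coefficient vectors) sends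
`E_{t,i,j}` to `X_t · adj(T)_{ji}` (`fderiv_detCoeffMap_single`), and these span all ternary forms
of degree `m` (`homogeneousSubmodule_le_tanSpan`: Usmani's adjugate `(-y)^{j-i} θ_i θ_{m-1-j}` and
the triangularity of continuant products), so `range dΦ_T = ⊤` (`range_fderiv_detCoeffMap`) and,
by the inverse function theorem (`HasStrictFDerivAt.map_nhds_eq_of_surj`), the determinantal
ternary forms contain a neighbourhood of `det T` (`range_detCoeffMap_mem_nhds`).
(2) IDENTITY THEOREM: for a test polynomial `p` of `mem_orbitClosure_iff` vanishing on `GL · det_m`,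
`w ↦ p(coeffVec (formOf w)(X_ℓ))` is analytic on the coefficient space (`analyticAt_coeff_aeval_formOf`,
`AnalyticAt.aeval_mvPolynomial`), vanishes on the image of `Φ` (pushed-forward determinants are
`End`-translates of `det_m`, `aeval_det_pencilOf_mem_orbitClosure`), hence near `Φ(T)`, hence
everywhere (`AnalyticOnNhd.eqOn_zero_of_preconnected_of_eventuallyEq_zero`).
COROLLARIES: `noValuativeFlip_of_card_parts_le_three` (no valuative flip on `≤ 3`-row shapes at
any `(n, m, U, r, δ)`), `four_le_card_parts_of_valuativeFlip` (every `ValuativeFlip` witness has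
`≥ 4` rows), `det_orbitMultiplicity_eq_plethysmCoeffOfPartition_of_card_parts_le_three` (D3:
`K_m(λ*) = a_λ(δ[m])` for `ℓ(λ) ≤ 3`, `Det_m` equation-free on three letters).

References: L. E. Dickson, *Determination of all general homogeneous polynomials expressible as
determinants with linear elements*, Trans. AMS 22 (1921); A. Beauville, *Determinantal
hypersurfaces*, Michigan Math. J. 48 (2000) §4; K. Mulmuley, M. Sohoni, SIAM J. Comput. 31 (2001)
§4 (orbit closures).  This crux: DECOMPOSITIONS.md §1 D3, cite item wi-32803.
-/

set_option linter.dupNamespace false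

namespace Summit.ValiantsHypothesis.ValiantsHypothesis.Theorems.ValuativeFlip

open MvPolynomial
open scoped BigOperators Matrix Topology
open Literature.NumberTheory.DiophantineGeometry Literature.Computability.AlgebraicComplexity
open Summit.ValiantsHypothesis.ValiantsHypothesis.Theses.ValuativeGCT

noncomputable section

/-- The parameter point of the tridiagonal Toeplitz pencil `T = x·1 + y·N + z·Nᵀ`. [this crux] -/
def triParam (n : ℕ) : PencilParam n := fun p =>
  if p.1 = 0 then (if (p.2.2 : ℕ) = p.2.1 then 1 else 0)
  else if p.1 = 1 then (if (p.2.2 : ℕ) = p.2.1 + 1 then 1 else 0)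
  else (if (p.2.1 : ℕ) = p.2.2 + 1 then 1 else 0)

/-- `pencil (triParam n) = triT n`. [this crux] -/
theorem pencilOf_triParam (n : ℕ) : pencilOf (triParam n) = triT n := by
  refine Matrix.ext fun i j => ?_
  simp only [pencilOf, triParam, triT, Matrix.of_apply, Fin.sum_univ_three, Fin.isValue,
    if_true, one_ne_zero, if_false]
  have h20 : ¬ ((2 : Fin 3) = 0) := by decide
  have h21 : ¬ ((2 : Fin 3) = 1) := by decide
  rw [if_neg h20, if_neg h21]
  by_cases h1 : (j : ℕ) = i
  · have h2 : ¬ ((j : ℕ) = i + 1) := by omega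
    have h3 : ¬ ((i : ℕ) = j + 1) := by omega
    simp only [if_pos h1, if_neg h2, if_neg h3, map_one, map_zero, one_mul, zero_mul, add_zero]
  · by_cases h2 : (j : ℕ) = i + 1
    · have h3 : ¬ ((i : ℕ) = j + 1) := by omega
      simp only [if_neg h1, if_pos h2, if_neg h3, map_one, map_zero, one_mul, zero_mul, add_zero,
        zero_add]
    · by_cases h3 : (i : ℕ) = j + 1
      · simp only [if_neg h1, if_neg h2, if_pos h3, map_one, map_zero, one_mul, zero_mul, zero_add]
      · simp only [if_neg h1, if_neg h2, if_neg h3, map_zero, zero_mul, zero_add]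

/-- **The differential at the tridiagonal pencil on single-entry directions**:
`dΦ_T (E_{t,i,j}) = coeffVec3 (X_t · adj(T)_{j i})`. [this crux] -/
theorem fderiv_detCoeffMap_single {n : ℕ} (t : Fin 3) (i j : Fin (n + 1)) :
    fderiv ℂ (detCoeffMap n) (triParam n) (Pi.single (t, i, j) (1 : ℂ)) =
      coeffVec3 n (X t * (triT n).adjugate j i) := by
  have h := fderiv_apply_of_affine_line (triParam n) (Pi.single (t, i, j) (1 : ℂ))
    (coeffVec3 n (X t * (triT n).adjugate j i)) (fun u => by
      rw [detCoeffMap_add_smul_single, pencilOf_triParam])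
  exact h

/-- **The differential of `Φ` at the tridiagonal Toeplitz pencil is surjective.** Every
coefficient vector `w` is `coeffVec3 (formOf w)`, `formOf w` is a ternary form of degree `n + 1`,
hence in `tanSpan n = span{X_t adj(T)_{ij}}` (`homogeneousSubmodule_le_tanSpan`), and the images
`coeffVec3 (X_t adj(T)_{ij}) = dΦ_T(E_{t,j,i})` lie in the range. [this crux] -/
theorem range_fderiv_detCoeffMap (n : ℕ) :
    (fderiv ℂ (detCoeffMap n) (triParam n)).range = ⊤ := by
  rw [eq_top_iff]
  rintro w -
  have hw : w = coeffVec3 n (formOf w) := (coeffVec3_formOf w).symm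
  have hmem : formOf w ∈ tanSpan n :=
    homogeneousSubmodule_le_tanSpan n (formOf_mem_homogeneousSubmodule w)
  have hmap : coeffVec3 n (formOf w) ∈ (tanSpan n).map (coeffVec3 n) :=
    Submodule.mem_map_of_mem hmem
  rw [tanSpan, Submodule.map_span] at hmap
  rw [hw]
  refine (Submodule.span_le.mpr ?_) hmap
  rintro _ ⟨_, ⟨⟨t, i, j⟩, rfl⟩, rfl⟩
  exact ⟨Pi.single (t, j, i) 1, fderiv_detCoeffMap_single t j i⟩

/-- **Submersion ⇒ open image**: the set of coefficient vectors of determinants of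
`(n+1) × (n+1)` pencils of ternary linear forms is a neighbourhood of `det T`
(inverse function theorem, `HasStrictFDerivAt.map_nhds_eq_of_surj`). [this crux] -/
theorem range_detCoeffMap_mem_nhds (n : ℕ) :
    Set.range (detCoeffMap n) ∈ 𝓝 (detCoeffMap n (triParam n)) := by
  have hstrict : HasStrictFDerivAt (detCoeffMap n) (fderiv ℂ (detCoeffMap n) (triParam n))
      (triParam n) :=
    (contDiff_detCoeffMap n).contDiffAt.hasStrictFDerivAt one_ne_zero
  rw [← hstrict.map_nhds_eq_of_surj (range_fderiv_detCoeffMap n)]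
  exact Filter.range_mem_map

/-! ## Every ternary form is border-determinantal -/

/-- **Generic Dickson, closure form.** For every `n` and every three letters `ℓ 0, ℓ 1, ℓ 2` of
`MatIdx (n+1)` (not necessarily distinct), every ternary form `q₃` of degree `n + 1`, evaluated at
those letters, lies in the orbit closure `Δ(det_{n+1})`.  Proof: for a test polynomial `p`
vanishing on `GL · det`, the function `F(w) = p(coeffVec (formOf w)(X_ℓ))` is analytic on the
coefficient space of ternary forms, vanishes on the image of the determinant map `Φ` (pushed-forward
determinants are `End`-translates of `det`), and that image is a neighbourhood of `Φ(T)`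
(`range_detCoeffMap_mem_nhds`, submersion at the tridiagonal Toeplitz pencil); by the
identity theorem `F ≡ 0`. [this crux; classical statement: L. E. Dickson, Trans. AMS 22 (1921);
A. Beauville, Michigan Math. J. 48 (2000)] -/
theorem aeval_ternaryForm_mem_orbitClosure_detFormLex {n : ℕ} (ℓ : Fin 3 → MatIdx (n + 1))
    {q₃ : MvPolynomial (Fin 3) ℂ} (hq : q₃.IsHomogeneous (n + 1)) :
    aeval (fun t => (X (ℓ t) : MvPolynomial (MatIdx (n + 1)) ℂ)) q₃ ∈
      orbitClosure (detFormLex ℂ (n + 1)) := by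
  classical
  rw [mem_orbitClosure_iff]
  intro p hp
  set F : FormCoeffs n → ℂ := fun w =>
    aeval (coeffVec (aeval (fun t => (X (ℓ t) : MvPolynomial (MatIdx (n + 1)) ℂ)) (formOf w))) p
    with hF
  have hanal : AnalyticOnNhd ℂ F Set.univ := fun z _ =>
    AnalyticAt.aeval_mvPolynomial
      (f := fun (w : FormCoeffs n) (d : MatIdx (n + 1) →₀ ℕ) =>
        coeffVec (aeval (fun t => (X (ℓ t) : MvPolynomial (MatIdx (n + 1)) ℂ)) (formOf w)) d)
      (fun d => analyticAt_coeff_aeval_formOf ℓ d z) p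
  have hvan : ∀ A : PencilParam n, F (detCoeffMap n A) = 0 := by
    intro A
    simp only [hF, formOf_detCoeffMap]
    exact (mem_orbitClosure_iff.mp (aeval_det_pencilOf_mem_orbitClosure n ℓ A)) p hp
  have hev : F =ᶠ[𝓝 (detCoeffMap n (triParam n))] 0 := by
    filter_upwards [range_detCoeffMap_mem_nhds n] with w hw
    obtain ⟨A, rfl⟩ := hw
    exact hvan A
  have hzero := hanal.eqOn_zero_of_preconnected_of_eventuallyEq_zero isPreconnected_univ
    (Set.mem_univ _) hev
  have h := hzero (Set.mem_univ (coeffVec3 n q₃))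
  simp only [hF, formOf_coeffVec3 hq, Pi.zero_apply] at h
  exact h

/-- **Ternary forms are border-determinantal.** A form `q` of degree `n + 1` in the matrix
variables `MatIdx (n+1)` whose variables are among three letters `ℓ 0, ℓ 1, ℓ 2` lies in
`Δ(det_{n+1})`. (Pull `q` back to `ℂ[x, y, z]` along `ℓ` and apply
`aeval_ternaryForm_mem_orbitClosure_detFormLex`.) [this crux] -/
theorem ternaryForm_mem_orbitClosure_detFormLex {n : ℕ}
    (ℓ : Fin 3 → MatIdx (n + 1)) {q : MvPolynomial (MatIdx (n + 1)) ℂ}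
    (hq : q.IsHomogeneous (n + 1)) (hvars : ↑q.vars ⊆ Set.range ℓ) :
    q ∈ orbitClosure (detFormLex ℂ (n + 1)) := by
  classical
  let φ : MatIdx (n + 1) → MvPolynomial (Fin 3) ℂ := fun l =>
    if h : ∃ t, ℓ t = l then X h.choose else 0
  have hφ : ∀ l, (φ l).IsHomogeneous 1 := by
    intro l
    simp only [φ]
    split_ifs with h
    · exact isHomogeneous_X ℂ _
    · exact isHomogeneous_zero _ _ _
  have hq₃ : (aeval φ q).IsHomogeneous (n + 1) := by
    simpa only [one_mul] using hq.aeval φ hφ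
  have hback : aeval (fun t => (X (ℓ t) : MvPolynomial (MatIdx (n + 1)) ℂ)) (aeval φ q) = q := by
    rw [← AlgHom.comp_apply, comp_aeval]
    conv_rhs => rw [← aeval_X_left_apply (R := ℂ) q]
    refine hom_congr_vars (by ext; simp) (fun l hl _ => ?_) rfl
    obtain ⟨t₀, ht₀⟩ : ∃ t, ℓ t = l := by
      simpa using hvars (Finset.mem_coe.mpr hl)
    have h : ∃ t, ℓ t = l := ⟨t₀, ht₀⟩
    simp only [AlgHom.toRingHom_eq_coe, RingHom.coe_coe, aeval_X, φ, dif_pos h]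
    rw [h.choose_spec]
  rw [← hback]
  exact aeval_ternaryForm_mem_orbitClosure_detFormLex ℓ hq₃

/-- The same for any `m ≥ 1` (`[NeZero m]`). [this crux] -/
theorem ternaryForm_mem_orbitClosure_detFormLex' (m : ℕ) [NeZero m]
    (ℓ : Fin 3 → MatIdx m) {q : MvPolynomial (MatIdx m) ℂ}
    (hq : q.IsHomogeneous m) (hvars : ↑q.vars ⊆ Set.range ℓ) :
    q ∈ orbitClosure (detFormLex ℂ m) := by
  obtain ⟨n, rfl⟩ : ∃ n, m = n + 1 := ⟨m - 1, by have := NeZero.pos m; omega⟩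
  exact ternaryForm_mem_orbitClosure_detFormLex ℓ hq hvars

/-- **Row 3 of the few-row table, det column: the hypothesis `H` (k := 3) of
`noFlip_of_topForms_mem_orbitClosure`, discharged.** Every form of degree `m` in the three
greatest lexicographic letters of `MatIdx m` lies in `Δ(det_m)`. [this crux] -/
theorem topThreeForms_mem_orbitClosure_detFormLex : ∀ (m : ℕ) [NeZero m] (q : MvPolynomial (MatIdx m) ℂ), q.IsHomogeneous m → (∀ i ∈ q.vars, m * m ≤ (((matIdxEquiv m).symm i : Fin (m * m)) : ℕ) + 3) → q ∈ orbitClosure (detFormLex ℂ m) := by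
  intro m _ q hq hv
  have hmm : 0 < m * m := Nat.mul_pos (NeZero.pos m) (NeZero.pos m)
  let ℓ : Fin 3 → MatIdx m := fun t => matIdxEquiv m ⟨m * m - 1 - t, by omega⟩
  refine ternaryForm_mem_orbitClosure_detFormLex' m ℓ hq fun i hi => ?_
  have h := hv i (Finset.mem_coe.mp hi)
  have hlt := ((matIdxEquiv m).symm i).2
  refine ⟨⟨m * m - 1 - ((matIdxEquiv m).symm i : ℕ), by omega⟩, ?_⟩
  simp only [ℓ]
  conv_rhs => rw [← (matIdxEquiv m).apply_symm_apply i]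
  congr 1
  exact Fin.ext (by simp; omega)

/-- A finite set with at most three elements is covered by the range of a map from `Fin 3`
(given a default element). [folklore] -/
theorem exists_fin3_range_superset_of_card_le_three {α : Type*} [DecidableEq α] (a₀ : α) (S : Finset α)
    (hS : S.card ≤ 3) : ∃ ℓ : Fin 3 → α, (↑S : Set α) ⊆ Set.range ℓ := by
  obtain ⟨l, hl, hlen⟩ : ∃ l : List α, l.toFinset = S ∧ l.length ≤ 3 :=
    ⟨S.toList, S.toList_toFinset, by rw [Finset.length_toList]; exact hS⟩
  subst hl
  match l, hlen with
  | [], _ => exact ⟨fun _ => a₀, by simp⟩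
  | [a], _ =>
    refine ⟨![a, a, a], fun x hx => ?_⟩
    simp only [List.toFinset_cons, List.toFinset_nil, insert_empty_eq, Finset.coe_singleton,
      Set.mem_singleton_iff] at hx
    exact ⟨0, by simp [hx]⟩
  | [a, b], _ =>
    refine ⟨![a, b, b], fun x hx => ?_⟩
    simp only [List.toFinset_cons, List.toFinset_nil, insert_empty_eq, Finset.coe_insert,
      Finset.coe_singleton, Set.mem_insert_iff, Set.mem_singleton_iff] at hx
    rcases hx with rfl | rfl
    · exact ⟨0, by simp⟩
    · exact ⟨1, by simp⟩
  | [a, b, c], _ =>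
    refine ⟨![a, b, c], fun x hx => ?_⟩
    simp only [List.toFinset_cons, List.toFinset_nil, insert_empty_eq, Finset.coe_insert,
      Finset.coe_singleton, Set.mem_insert_iff, Set.mem_singleton_iff] at hx
    rcases hx with rfl | rfl | rfl
    · exact ⟨0, by simp⟩
    · exact ⟨1, by simp⟩
    · exact ⟨2, by simp⟩
  | _ :: _ :: _ :: _ :: _, h =>
    exfalso
    simp only [List.length_cons] at h
    omega

/-- **Three-letter substitutions of a form of degree `m` lie in `Δ(det_m)`.** For `g` homogeneous
of degree `m ≥ 1`, a set `S` of at most three letters, and a matrix `A` whose rows outside `S`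
vanish, `A · g ∈ Δ(det_m)` (the substituted form only involves the letters of `S`, and ternary
forms are border-determinantal, `ternaryForm_mem_orbitClosure_detFormLex'`).
[this crux] -/
theorem linSubst_three_letters_mem_orbitClosure_detFormLex {m : ℕ} [NeZero m]
    {g : MvPolynomial (MatIdx m) ℂ} (hg : g.IsHomogeneous m) (S : Finset (MatIdx m))
    (hS : S.card ≤ 3) (A : Matrix (MatIdx m) (MatIdx m) ℂ) (hA : ∀ i, i ∉ S → ∀ j, A i j = 0) :
    linSubst (MatIdx m) ℂ A g ∈ orbitClosure (detFormLex ℂ m) := by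
  classical
  have a₀ : MatIdx m := toLex ((0 : Fin m), (0 : Fin m))
  obtain ⟨ℓ, hℓ⟩ := exists_fin3_range_superset_of_card_le_three a₀ S hS
  have hvars : ↑(linSubst (MatIdx m) ℂ A g).vars ⊆ Set.range ℓ := by
    refine vars_linSubst_subset (A := Finset.univ) A (fun x l _ hx => hA x (fun hxS => hx (hℓ ?_)) l)
      (by simp)
    exact Finset.mem_coe.mpr hxS
  exact ternaryForm_mem_orbitClosure_detFormLex' m ℓ (linSubst_isHomogeneous A hg) hvars

/-- **`Det_m` majorises every orbit closure on three letters.** For every form `g` of degree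
`m ≥ 1` in the matrix variables and every weight `χ` of `GL_{m²}` supported on at most three
letters, `mult_χ ℂ[Δ_m(g)] ≤ mult_χ ℂ[Δ(det_m)]` (support transfer,
`NoValuativeFlip.orbitMultiplicity_le_of_weight_support`). [this crux] -/
theorem orbitMultiplicity_le_det_of_support_card_le_three {m : ℕ} [NeZero m] {g : MvPolynomial (MatIdx m) ℂ}
    (hg : g.IsHomogeneous m) (S : Finset (MatIdx m)) (hS : S.card ≤ 3)
    (χ : Weight (MatIdx m)) (hχ : ∀ i, i ∉ S → χ i = 0) :
    orbitMultiplicity ℂ g m χ ≤ orbitMultiplicity ℂ (detFormLex ℂ m) m χ :=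
  NoValuativeFlip.orbitMultiplicity_le_of_weight_support (detFormLex ℂ m) g (NeZero.ne m) S
    (fun A hA => linSubst_three_letters_mem_orbitClosure_detFormLex hg S hS A hA) χ hχ

/-! ## No valuative flip on shapes with at most three rows -/

/-- **No valuative flip on shapes with at most three rows.** For every `n ≤ m`, every centre
`(U, r)` with ranks `≤ r` on `U`, every `δ` and every `λ ⊢ mδ` with at most three rows (and
`ℓ(λ) ≤ m²`), the crux's truncation `T_U(λ)` (verbatim body of `ValuativeGCT.ValuativeFlip`)
satisfies `mult_pp(λ*) ≤ dim T_U(λ)` — the `ValuativeFlip` inequality fails.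
(`noFlip_of_topForms_mem_orbitClosure` at `k = 3`, its hypothesis discharged by
`topThreeForms_mem_orbitClosure_detFormLex`.)  Unconditional; extends `no_twoRow_flip`.
[this crux] -/
theorem noValuativeFlip_of_card_parts_le_three {n : ℕ} (m : ℕ) [NeZero m] (hnm : n ≤ m)
    (U : Submodule ℂ (MatIdx m → ℂ)) (r : ℕ)
    (hU : ∀ u ∈ U, (Matrix.of fun a b : Fin m => u (toLex (a, b))).rank ≤ r)
    (δ : ℕ) (lam : Nat.Partition (m * δ)) (h3 : lam.parts.card ≤ 3) (hcard : lam.parts.card ≤ m * m) :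
    let χ : Literature.NumberTheory.DiophantineGeometry.Weight (Literature.NumberTheory.DiophantineGeometry.MatIdx m) := (Literature.NumberTheory.DiophantineGeometry.Weight.dualOfPartition (m * m) lam).toMatIdx; let T : Submodule ℂ (MvPolynomial (Literature.NumberTheory.DiophantineGeometry.MatIdx m × Literature.NumberTheory.DiophantineGeometry.MatIdx m) ℂ) := MvPolynomial.homogeneousSubmodule (Literature.NumberTheory.DiophantineGeometry.MatIdx m × Literature.NumberTheory.DiophantineGeometry.MatIdx m) ℂ (m * δ) ⊓ ((MvPolynomial.vanishingIdeal ℂ {p : Literature.NumberTheory.DiophantineGeometry.MatIdx m × Literature.NumberTheory.DiophantineGeometry.MatIdx m → ℂ | ∀ j : Literature.NumberTheory.DiophantineGeometry.MatIdx m, (fun i => p (j, i)) ∈ U}) ^ (δ * (m - r))).restrictScalars ℂ ⊓ (⨅ (M : Matrix (Literature.NumberTheory.DiophantineGeometry.MatIdx m) (Literature.NumberTheory.DiophantineGeometry.MatIdx m) ℂ) (_ : Literature.Computability.AlgebraicComplexity.linSubst (Literature.NumberTheory.DiophantineGeometry.MatIdx m) ℂ M (Literature.NumberTheory.DiophantineGeometry.detFormLex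 ℂ m) = Literature.NumberTheory.DiophantineGeometry.detFormLex ℂ m), LinearMap.ker ((MvPolynomial.aeval (R := ℂ) fun p : Literature.NumberTheory.DiophantineGeometry.MatIdx m × Literature.NumberTheory.DiophantineGeometry.MatIdx m => ∑ l : Literature.NumberTheory.DiophantineGeometry.MatIdx m, M l p.2 • MvPolynomial.X (p.1, l)).toLinearMap - LinearMap.id (R := ℂ) (M := MvPolynomial (Literature.NumberTheory.DiophantineGeometry.MatIdx m × Literature.NumberTheory.DiophantineGeometry.MatIdx m) ℂ))) ⊓ (⨅ (g : Matrix.GeneralLinearGroup (Literature.NumberTheory.DiophantineGeometry.MatIdx m) ℂ) (_ : Literature.NumberTheory.DiophantineGeometry.IsUpperTriangular g), LinearMap.ker ((MvPolynomial.aeval (R := ℂ) fun p : Literature.NumberTheory.DiophantineGeometry.MatIdx m × Literature.NumberTheory.DiophantineGeometry.MatIdx m => ∑ l : Literature.NumberTheory.DiophantineGeometry.MatIdx m, ((g⁻¹ : Matrix.GeneralLinearGroup (Literature.NumberTheory.DiophantineGeometry.MatIdx m) ℂ) : Matrix (Literature.NumberTheory.DiophantineGeometry.MatIdx m) (Literature.NumberTheory.DiophantineGeometry.MatIdx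 m) ℂ) p.1 l • MvPolynomial.X (l, p.2)).toLinearMap - Literature.NumberTheory.DiophantineGeometry.weightChar χ g • LinearMap.id (R := ℂ) (M := MvPolynomial (Literature.NumberTheory.DiophantineGeometry.MatIdx m × Literature.NumberTheory.DiophantineGeometry.MatIdx m) ℂ))); Literature.NumberTheory.DiophantineGeometry.orbitMultiplicity ℂ (Literature.NumberTheory.DiophantineGeometry.paddedPerFormLex ℂ n m) m χ ≤ Module.finrank ℂ ↥T :=
  noFlip_of_topForms_mem_orbitClosure m hnm 3 (topThreeForms_mem_orbitClosure_detFormLex m) U r hU δ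
    lam h3 hcard

/-- **Every valuative-flip witness has at least four rows.** If the crux's inequality
`dim T_U(λ) < mult_pp(λ*)` holds at some admissible `(n, m, U, r, δ, λ)` (`n ≤ m`, ranks `≤ r` on
`U`, `ℓ(λ) ≤ m²`), then `4 ≤ ℓ(λ)`: the shapes produced by line `four-row-count`
(`stub_fourRowBridge`, `ℓ(λ) ≤ 4`) have EXACTLY four rows, and four rows is the first row of the
few-row table where a flip can live. [this crux] -/
theorem four_le_card_parts_of_valuativeFlip {n : ℕ} (m : ℕ) [NeZero m] (hnm : n ≤ m)
    (U : Submodule ℂ (MatIdx m → ℂ)) (r : ℕ)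
    (hU : ∀ u ∈ U, (Matrix.of fun a b : Fin m => u (toLex (a, b))).rank ≤ r)
    (δ : ℕ) (lam : Nat.Partition (m * δ)) (hcard : lam.parts.card ≤ m * m)
    (hflip : let χ : Literature.NumberTheory.DiophantineGeometry.Weight (Literature.NumberTheory.DiophantineGeometry.MatIdx m) := (Literature.NumberTheory.DiophantineGeometry.Weight.dualOfPartition (m * m) lam).toMatIdx; let T : Submodule ℂ (MvPolynomial (Literature.NumberTheory.DiophantineGeometry.MatIdx m × Literature.NumberTheory.DiophantineGeometry.MatIdx m) ℂ) := MvPolynomial.homogeneousSubmodule (Literature.NumberTheory.DiophantineGeometry.MatIdx m × Literature.NumberTheory.DiophantineGeometry.MatIdx m) ℂ (m * δ) ⊓ ((MvPolynomial.vanishingIdeal ℂ {p : Literature.NumberTheory.DiophantineGeometry.MatIdx m × Literature.NumberTheory.DiophantineGeometry.MatIdx m → ℂ | ∀ j : Literature.NumberTheory.DiophantineGeometry.MatIdx m, (fun i => p (j, i)) ∈ U}) ^ (δ * (m - r))).restrictScalars ℂ ⊓ (⨅ (M : Matrix (Literature.NumberTheory.DiophantineGeometry.MatIdx m) (Literature.NumberTheory.DiophantineGeometry.MatIdx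 m) ℂ) (_ : Literature.Computability.AlgebraicComplexity.linSubst (Literature.NumberTheory.DiophantineGeometry.MatIdx m) ℂ M (Literature.NumberTheory.DiophantineGeometry.detFormLex ℂ m) = Literature.NumberTheory.DiophantineGeometry.detFormLex ℂ m), LinearMap.ker ((MvPolynomial.aeval (R := ℂ) fun p : Literature.NumberTheory.DiophantineGeometry.MatIdx m × Literature.NumberTheory.DiophantineGeometry.MatIdx m => ∑ l : Literature.NumberTheory.DiophantineGeometry.MatIdx m, M l p.2 • MvPolynomial.X (p.1, l)).toLinearMap - LinearMap.id (R := ℂ) (M := MvPolynomial (Literature.NumberTheory.DiophantineGeometry.MatIdx m × Literature.NumberTheory.DiophantineGeometry.MatIdx m) ℂ))) ⊓ (⨅ (g : Matrix.GeneralLinearGroup (Literature.NumberTheory.DiophantineGeometry.MatIdx m) ℂ) (_ : Literature.NumberTheory.DiophantineGeometry.IsUpperTriangular g), LinearMap.ker ((MvPolynomial.aeval (R := ℂ) fun p : Literature.NumberTheory.DiophantineGeometry.MatIdx m × Literature.NumberTheory.DiophantineGeometry.MatIdx m => ∑ l : Literature.NumberTheory.DiophantineGeometry.MatIdx m, ((g⁻¹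 : Matrix.GeneralLinearGroup (Literature.NumberTheory.DiophantineGeometry.MatIdx m) ℂ) : Matrix (Literature.NumberTheory.DiophantineGeometry.MatIdx m) (Literature.NumberTheory.DiophantineGeometry.MatIdx m) ℂ) p.1 l • MvPolynomial.X (l, p.2)).toLinearMap - Literature.NumberTheory.DiophantineGeometry.weightChar χ g • LinearMap.id (R := ℂ) (M := MvPolynomial (Literature.NumberTheory.DiophantineGeometry.MatIdx m × Literature.NumberTheory.DiophantineGeometry.MatIdx m) ℂ))); Module.finrank ℂ ↥T < Literature.NumberTheory.DiophantineGeometry.orbitMultiplicity ℂ (Literature.NumberTheory.DiophantineGeometry.paddedPerFormLex ℂ n m) m χ) :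
    4 ≤ lam.parts.card := by
  by_contra h
  exact absurd hflip (not_lt.mpr (noValuativeFlip_of_card_parts_le_three m hnm U r hU δ lam (by omega) hcard))

/-! ## `Det_m` is equation-free on three letters: `K_m(λ*) = a_λ(δ[m])` for `ℓ(λ) ≤ 3` -/

/-- **A weight vector supported on three letters that vanishes on `Δ(det_m)` is zero** (locality
of weight vectors + three-letter forms lie in `Δ(det_m)`; cf. the two-letter version
`weightVector_eq_zero_of_mem_orbitVanishingIdeal_det_of_card_le_two`). [this crux] -/
theorem weightVector_three_letters_eq_zero_of_mem_orbitVanishingIdeal_det {m : ℕ} [NeZero m]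
    (S : Finset (MatIdx m)) (hS : S.card ≤ 3) {χ : Weight (MatIdx m)} (hχ : ∀ i, i ∉ S → χ i = 0)
    {F : MvPolynomial (DegIdx (MatIdx m) m) ℂ} (hF : F ∈ weightSpace (coordRep (MatIdx m) ℂ m) χ)
    (hFI : F ∈ orbitVanishingIdeal (detFormLex ℂ m) m) : F = 0 := by
  classical
  apply MvPolynomial.funext
  intro c
  rw [map_zero]
  set q : MvPolynomial (MatIdx m) ℂ := ∑ d : DegIdx (MatIdx m) m, c d • monomial d.1 (1 : ℂ) with hq
  have hcq : formCoeff m q = c := formCoeff_sum_smul_monomial c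
  set D : Matrix (MatIdx m) (MatIdx m) ℂ := Matrix.diagonal fun i => if i ∈ S then (1 : ℂ) else 0
    with hD
  have hrows : ∀ i, i ∉ S → ∀ j, D i j = 0 := by
    intro i hi j
    rw [hD, Matrix.diagonal_apply, if_neg hi]
    split_ifs <;> rfl
  have hmem : linSubst (MatIdx m) ℂ D q ∈ orbitClosure (detFormLex ℂ m) :=
    linSubst_three_letters_mem_orbitClosure_detFormLex (isHomogeneous_sum_smul_monomial c) S hS D
      hrows
  have hFI' := orbitVanishingIdeal_le_of_mem_orbitClosure (m := m) hmem hFI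
  have h1 := mem_orbitVanishingIdeal_iff.mp hFI' 1
  simp only [map_one, Module.End.one_apply] at h1
  change aeval c F = 0
  rw [← hcq, NoValuativeFlip.aeval_formCoeff_eq_of_mem_weightSpace S hχ hF q]
  exact h1

/-- **`Det_m` is equation-free on three letters: `K_m(χ) = pleth(χ)`** for every weight `χ` of
`GL_{m²}` supported on at most three letters (`m ≥ 1`). [this crux] -/
theorem det_orbitMultiplicity_eq_plethysmCoeff_of_support_card_le_three {m : ℕ} [NeZero m]
    (S : Finset (MatIdx m)) (hS : S.card ≤ 3) (χ : Weight (MatIdx m)) (hχ : ∀ i, i ∉ S → χ i = 0) :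
    orbitMultiplicity ℂ (detFormLex ℂ m) m χ = plethysmCoeff ℂ (MatIdx m) m χ := by
  classical
  set V : Submodule ℂ (MvPolynomial (DegIdx (MatIdx m) m) ℂ) :=
    highestWeightSpace (coordRep (MatIdx m) ℂ m) χ with hV
  haveI : FiniteDimensional ℂ V :=
    finiteDimensional_highestWeightSpace_coordRep_holds (NeZero.ne m) χ
  let π : (coordRep (MatIdx m) ℂ m).IntertwiningMap (orbitCoordRep (detFormLex ℂ m) m) :=
    ⟨(Ideal.Quotient.mkₐ ℂ (orbitVanishingIdeal (detFormLex ℂ m) m)).toLinearMap,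
      fun _ => LinearMap.ext fun _ => rfl⟩
  have hmap := map_highestWeightSpace_eq_of_surjective π (Ideal.Quotient.mkₐ_surjective ℂ _)
    (isSemisimpleRepresentation_coordRep m) χ
  have hr := LinearMap.finrank_range_add_finrank_ker (π.toLinearMap ∘ₗ V.subtype)
  rw [LinearMap.range_comp, Submodule.range_subtype] at hr
  have hker : LinearMap.ker (π.toLinearMap ∘ₗ V.subtype) = ⊥ := by
    rw [Submodule.eq_bot_iff]
    intro F hF0
    rw [LinearMap.mem_ker, LinearMap.comp_apply] at hF0
    have hFI : (F : MvPolynomial (DegIdx (MatIdx m) m) ℂ) ∈ orbitVanishingIdeal (detFormLex ℂ m) m :=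
      Ideal.Quotient.eq_zero_iff_mem.mp hF0
    exact Subtype.ext (weightVector_three_letters_eq_zero_of_mem_orbitVanishingIdeal_det S hS hχ
      (highestWeightSpace_le_weightSpace _ _ F.2) hFI)
  rw [hker, finrank_bot, add_zero] at hr
  unfold orbitMultiplicity plethysmCoeff hwMultiplicity
  rw [← hmap, ← hV]
  exact hr

/-- **Row `≤ 3` of the few-row table, determinant column: `K_m(λ*) = a_λ(δ[m])`** (D3
`threeRowIdentity` of DECOMPOSITIONS.md). For `λ ⊢ d` with `ℓ(λ) ≤ 3` and any `k` with
`ℓ(λ) ≤ k ≤ m²`, the multiplicity of `λ*` in `ℂ[Δ(det_m)]` equals the `GL_k` plethysm coefficient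
`plethysmCoeffOfPartition ℂ k m λ`. With `orbitMultiplicity_paddedPer_le_plethysmCoeffOfPartition`:
on shapes with at most three rows the per side of the crux is at most, and the det side is exactly,
`a_λ(δ[m])` — for every centre `U`, at every window position. [this crux] -/
theorem det_orbitMultiplicity_eq_plethysmCoeffOfPartition_of_card_parts_le_three : ∀ {m : ℕ} [NeZero m] {k d : ℕ}, k ≤ m * m → ∀ (lam : Nat.Partition d), lam.parts.card ≤ 3 → lam.parts.card ≤ k → orbitMultiplicity ℂ (detFormLex ℂ m) m (Weight.dualOfPartition (m * m) lam).toMatIdx = plethysmCoeffOfPartition ℂ k m lam := by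
  intro m _ k d hk lam h3 hlam
  classical
  rw [← plethysmCoeff_toMatIdx_eq_plethysmCoeffOfPartition hk lam hlam]
  set ρ := lam.parts.card with hρ
  have hρm : ρ ≤ m * m := hlam.trans hk
  let S : Finset (MatIdx m) := Finset.univ.image fun t : Fin ρ =>
    matIdxEquiv m ⟨m * m - 1 - t, by have := t.2; omega⟩
  have hScard : S.card ≤ 3 := Finset.card_image_le.trans (by simpa using h3)
  have hχ : ∀ i, i ∉ S → (Weight.dualOfPartition (m * m) lam).toMatIdx i = 0 := by
    intro i hi
    obtain ⟨i', rfl⟩ : ∃ i' : Fin (m * m), matIdxEquiv m i' = i :=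
      ⟨(matIdxEquiv m).symm i, (matIdxEquiv m).apply_symm_apply i⟩
    by_cases hlt : (i' : ℕ) + ρ < m * m
    · exact NoValuativeFlip.dualOfPartition_toMatIdx_eq_zero_of_lt lam i' hlt
    · exfalso
      apply hi
      refine Finset.mem_image.mpr ⟨⟨m * m - 1 - i', by omega⟩, Finset.mem_univ _, ?_⟩
      congr 1
      exact Fin.ext (by simp; omega)
  exact det_orbitMultiplicity_eq_plethysmCoeff_of_support_card_le_three S hScard _ hχ

end

end Summit.ValiantsHypothesis.ValiantsHypothesis.Theorems.ValuativeFlip
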